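import Literature.MathematicalPhysics.QuantumFieldTheory.OSBoostOneParameter
import Literature.MathematicalPhysics.QuantumFieldTheory.OSTimeTubeUniqueness
import HarnessLib

/-!
# A uniform bound for the regularised OS boundary values on the boost orbit of a test function

Support file (everything proved; no definitions, no named facts) for (B)
`Literature.MathematicalPhysics.QuantumFieldTheory.OS1973_lorentzInvariant_of_timeContinuation`
(`OSTimeContinuation`; Osterwalder–Schrader I (1973), §4.2). To exponentiate the infinitesimal
boost invariance `X_{0j} T = 0` of the time-ray boundary value `T` of an OS time continuation `𝔚`
(`OSInfinitesimalBoost`) to the invariance of `T` under the boosts `B_j(s)`, without differential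
calculus for Schwartz-space-valued curves, the sequel differentiates the *regularised* pairings
`s ↦ ∫ 𝔚(x + itη) F(B(−s)x) dx` at fixed `t > 0` (`OSBoostOneParameter`), where the derivative is
`it ∫ 𝔚(x + itη) (𝒟(F ∘ B(−s)))(x) dx`, `𝒟 = ∑ₖ η⁰_k ∂_{(k,j)}`, and needs these integrals to be
**bounded uniformly in `t ∈ (0, 1]` and `|s| ≤ s₀`** (`exists_bound_integral_rayC_mul_boostDeriv`).
This file proves that bound by the uniform boundedness principle in the test-function space `𝓓_K`
(the tree's `ContDiffMapSupportedIn.exists_supSeminorm_bound`, as in `OSTimeTubeUniqueness`):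

* the distributions `ψ ↦ ∫ 𝔚(x + itη) ψ(x) dx`, `t ∈ (0, 1]`, are pointwise bounded on `𝓓_K`
  (they are continuous in `t` and converge to `T ψ` as `t → 0⁺`), hence bounded by a common
  multiple of a `C^m` norm;
* the functions `𝒟(F ∘ B(−s))`, `|s| ≤ s₀`, lie in a fixed `𝓓_K` with uniformly bounded `C^m`
  norms: they are the slices `x ↦ 𝒢(s, x)` of one smooth function `𝒢` of `(s, x)`
  (`OSBoostOneParameter.contDiff_boost_neg_diag`), and the derivatives of a slice are bounded by
  those of `𝒢` (`norm_iteratedFDeriv_slice_le`: the slice is `𝒢` composed with the affine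
  embedding `x ↦ (s, x)`, of operator norm `≤ 1`).

## References

* K. Osterwalder, R. Schrader, *Axioms for Euclidean Green's functions*, Comm. Math. Phys. 31
  (1973) 83–112, §4.2. [OsterwalderSchraderCMP1973]
* W. Rudin, *Functional Analysis* (1991), Thm. 2.6 (Banach–Steinhaus), Thm. 6.8. [Rudin1991]
-/

noncomputable section

open Filter Complex Set MeasureTheory Metric ContDiffMapSupportedIn
open scoped Topology ContDiff Distributions
open Literature.MathematicalPhysics.QuantumLattice
open Literature.MathematicalPhysics.QuantumLattice.ContDiffMapSupportedIn

namespace Literature.MathematicalPhysics.QuantumFieldTheory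

variable {d n : ℕ}

/-! ### Derivatives of slices of a smooth function of two variables -/

/-- **The partial derivative of a slice is the total derivative on `(0, v)`.** [folklore] -/
theorem fderiv_slice_apply {X F : Type*} [NormedAddCommGroup X] [NormedSpace ℝ X]
    [NormedAddCommGroup F] [NormedSpace ℝ F] {𝒢 : ℝ × X → F} {r : ℝ} {x : X}
    (h : DifferentiableAt ℝ 𝒢 (r, x)) (v : X) :
    fderiv ℝ (fun x => 𝒢 (r, x)) x v = fderiv ℝ 𝒢 (r, x) (0, v) := by
  have hc : HasFDerivAt (fun x : X => 𝒢 (r, x)) ((fderiv ℝ 𝒢 (r, x)).comp (ContinuousLinearMap.inr ℝ ℝ X)) x :=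
    h.hasFDerivAt.comp x (hasFDerivAt_prodMk_right r x)
  rw [hc.fderiv, ContinuousLinearMap.comp_apply, ContinuousLinearMap.inr_apply]

/-- **The derivatives of a slice `x ↦ 𝒢(r, x)` of a smooth function are bounded by those of `𝒢`**:
`‖Dⁱ(𝒢(r, ·))(x)‖ ≤ ‖Dⁱ𝒢(r, x)‖` (the slice is `𝒢 ∘ (z ↦ (r, 0) + z) ∘ inr`, and `‖inr‖ ≤ 1`). [folklore] -/
theorem norm_iteratedFDeriv_slice_le {X F : Type*} [NormedAddCommGroup X] [NormedSpace ℝ X]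
    [NormedAddCommGroup F] [NormedSpace ℝ F] {𝒢 : ℝ × X → F} (h𝒢 : ContDiff ℝ ∞ 𝒢) (r : ℝ)
    (x : X) (i : ℕ) :
    ‖iteratedFDeriv ℝ i (fun x => 𝒢 (r, x)) x‖ ≤ ‖iteratedFDeriv ℝ i 𝒢 (r, x)‖ := by
  have hfun : (fun x : X => 𝒢 (r, x)) =
      (fun z : ℝ × X => 𝒢 (((r, (0 : X)) : ℝ × X) + z)) ∘ (ContinuousLinearMap.inr ℝ ℝ X) := by
    funext x; simp
  have hsh : ContDiff ℝ ∞ fun z : ℝ × X => 𝒢 (((r, (0 : X)) : ℝ × X) + z) :=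
    h𝒢.comp (contDiff_const.add contDiff_id)
  rw [hfun, ContinuousLinearMap.iteratedFDeriv_comp_right _ hsh x (by exact_mod_cast le_top),
    iteratedFDeriv_comp_add_left]
  refine (ContinuousMultilinearMap.norm_compContinuousLinearMap_le _ _).trans ?_
  have hpt : ((r, (0 : X)) : ℝ × X) + (ContinuousLinearMap.inr ℝ ℝ X) x = (r, x) := by simp
  rw [hpt]
  refine mul_le_of_le_one_right (norm_nonneg _) ?_
  exact Finset.prod_le_one (fun _ _ => norm_nonneg _) fun _ _ => ContinuousLinearMap.norm_inr_le_one ℝ ℝ X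

/-! ### The uniform bound -/

variable {𝔚 : (Fin n → Fin (d + 1) → ℂ) → ℂ} {T : SchwartzMap (Fin n → SpaceTime d) ℂ →L[ℂ] ℂ}

/-- **Uniform boundedness of the regularised boundary values on the boost orbit of a test
function**: for `𝔚` continuous on the time tube, holomorphic in the times, with time-ray boundary
value `T`, a temporal `η`, a smooth compactly supported `F`, a spatial direction `j` and `s₀ ≥ 0`,
the integrals `∫ 𝔚(x + itη) (∑ₖ η⁰_k ∂_{(k,j)}(F ∘ B_j(−s)))(x) dx` are bounded uniformly in
`t ∈ (0, 1]` and `|s| ≤ s₀` (Banach–Steinhaus in `𝓓_K`). [cite: Rudin1991, Thm 2.6] -/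
theorem exists_bound_integral_rayC_mul_boostDeriv (hc : ContinuousOn 𝔚 (timeTube d n))
    (hh : IsTimeHolomorphicOn 𝔚 (timeTube d n)) (hT : HasTimeRayBoundaryValue 𝔚 T)
    {η : Fin n → SpaceTime d} (hη : η ∈ temporalCone d n) (j : Fin d)
    {F : (Fin n → SpaceTime d) → ℂ} (hF : ContDiff ℝ ∞ F) (hFc : HasCompactSupport F) (s₀ : ℝ) :
    ∃ M : ℝ, ∀ t ∈ Ioc (0 : ℝ) 1, ∀ s : ℝ, |s| ≤ s₀ →
      ‖∫ x, 𝔚 (rayC x η ((t : ℂ) * I)) *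
        ∑ k, ((η k 0 : ℝ) : ℂ) * fderiv ℝ (fun x : Fin n → SpaceTime d => F fun k => boost j (-s) (x k)) x
          (Pi.single k (EuclideanSpace.single j.succ (1 : ℝ)))‖ ≤ M := by
  have hIt : ∀ {t : ℝ}, 0 < t → 0 < ((t : ℂ) * I).im := fun ht => by simpa using ht
  have hVc : ∀ {t : ℝ}, 0 < t → Continuous fun x : Fin n → SpaceTime d => 𝔚 (rayC x η ((t : ℂ) * I)) :=
    fun ht => continuous_comp_rayC_of_continuousOn_timeTube hc hη (hIt ht)
  -- the compact set carrying the boost orbit of the support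
  obtain ⟨R, hR⟩ := (isCompact_image_boost_diag (n := n) j hFc.isCompact s₀).isBounded.subset_closedBall 0
  let K : TopologicalSpace.Compacts (Fin n → SpaceTime d) := ⟨closedBall 0 R, isCompact_closedBall 0 R⟩
  have hKmem : ∀ s : ℝ, |s| ≤ s₀ → ∀ x : Fin n → SpaceTime d,
      (fun k => boost j (-s) (x k)) ∈ tsupport F → x ∈ (K : Set (Fin n → SpaceTime d)) := by
    intro s hs x hx
    refine hR ⟨(s, fun k => boost j (-s) (x k)), ⟨?_, hx⟩, funext fun k => boost_apply_boost_neg j s (x k)⟩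
    simpa [Real.norm_eq_abs] using hs
  have hzero : ∀ s : ℝ, |s| ≤ s₀ → ∀ x, x ∉ (K : Set (Fin n → SpaceTime d)) →
      fderiv ℝ (fun x : Fin n → SpaceTime d => F fun k => boost j (-s) (x k)) x = 0 := by
    intro s hs x hx
    refine fderiv_of_notMem_tsupport ℝ fun hx' => hx (hKmem s hs x ?_)
    have hcont : Continuous fun x : Fin n → SpaceTime d => fun k => boost j (-s) (x k) :=
      continuous_pi fun k => (boost j (-s)).continuous.comp (continuous_apply k)
    exact tsupport_comp_subset_preimage F hcont hx'
  -- the family of distributions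
  let Λ : ℝ → 𝓓_{K}((Fin n → SpaceTime d), ℂ) →L[ℝ] ℂ := fun t =>
    if ht : 0 < t then integralTestCLM (fun x => 𝔚 (rayC x η ((t : ℂ) * I))) (hVc ht) K volume
    else 0
  have hΛ : ∀ {t : ℝ}, 0 < t → ∀ ψ : 𝓓_{K}((Fin n → SpaceTime d), ℂ),
      Λ t ψ = ∫ x, 𝔚 (rayC x η ((t : ℂ) * I)) * ψ x := by
    intro t ht ψ
    simp only [Λ, dif_pos ht]
    exact integralTestCLM_apply _ _ _ _ _
  -- pointwise boundedness on `(0, 1]`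
  have hbdd : ∀ ψ : 𝓓_{K}((Fin n → SpaceTime d), ℂ), ∃ C, ∀ t ∈ Ioc (0 : ℝ) 1, ‖Λ t ψ‖ ≤ C := by
    intro ψ
    let ψS := ψ.compact_supp.toSchwartzMap ψ.contDiff
    have hlim : Tendsto (fun t : ℝ => Λ t ψ - T ψS) (𝓝[>] 0) (𝓝 0) := by
      have h := (hT η hη ψS).sub_const (T ψS)
      rw [sub_self] at h
      refine h.congr' ?_
      filter_upwards [self_mem_nhdsWithin] with t ht
      rw [hΛ ht ψ]
      rfl
    have hΦψ : ∀ t : ℝ, 0 < t →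
        ContinuousAt (fun t : ℝ => ∫ x, 𝔚 (rayC x η ((t : ℂ) * I)) * ψ x) t := by
      intro t ht
      have hd := differentiableAt_integral_rayC_of_isTimeHolomorphicOn hc hh hη ψ.continuous
        ψ.compact_supp (hIt ht)
      exact hd.continuousAt.comp (f := fun t : ℝ => (t : ℂ) * I)
        (by fun_prop : Continuous fun t : ℝ => (t : ℂ) * I).continuousAt
    have hcont : ContinuousOn (fun t : ℝ => Λ t ψ - T ψS) (Ioc 0 1) := by
      intro t ht
      refine (((hΦψ t ht.1).congr ?_).sub continuousAt_const).continuousWithinAt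
      filter_upwards [(isOpen_lt continuous_const continuous_id).mem_nhds ht.1] with t' ht'
      exact (hΛ ht' ψ).symm
    obtain ⟨C, hC⟩ := exists_bound_of_continuousOn_of_tendsto hcont hlim
    refine ⟨C + ‖T ψS‖, fun t ht => ?_⟩
    calc ‖Λ t ψ‖ = ‖(Λ t ψ - T ψS) + T ψS‖ := by rw [sub_add_cancel]
      _ ≤ ‖Λ t ψ - T ψS‖ + ‖T ψS‖ := norm_add_le _ _
      _ ≤ C + ‖T ψS‖ := by gcongr; exact hC t ht
  obtain ⟨m, C, hC0, hC⟩ := exists_supSeminorm_bound Λ 1 hbdd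
  -- the smooth function of `(s, x)` whose slices are the derivatives on the orbit
  let H : ℝ × (Fin n → SpaceTime d) → ℂ := fun q => F fun k => boost j (-q.1) (q.2 k)
  have hH : ContDiff ℝ ∞ H := hF.comp (contDiff_boost_neg_diag j)
  have hH' : ContDiff ℝ ∞ (fderiv ℝ H) := hH.fderiv_right (by simp)
  let 𝒢 : ℝ × (Fin n → SpaceTime d) → ℂ := fun q =>
    ∑ k, ((η k 0 : ℝ) : ℂ) * fderiv ℝ H q ((0 : ℝ), (Pi.single k (EuclideanSpace.single j.succ (1 : ℝ)) :
      Fin n → SpaceTime d))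
  have h𝒢 : ContDiff ℝ ∞ 𝒢 := by
    refine ContDiff.sum fun k _ => contDiff_const.mul ?_
    exact (ContinuousLinearMap.apply ℝ ℂ (((0 : ℝ), (Pi.single k (EuclideanSpace.single j.succ (1 : ℝ)) :
      Fin n → SpaceTime d)) : ℝ × (Fin n → SpaceTime d))).contDiff.comp hH'
  have h𝒢slice : ∀ (s : ℝ) (x : Fin n → SpaceTime d),
      (∑ k, ((η k 0 : ℝ) : ℂ) * fderiv ℝ (fun x : Fin n → SpaceTime d => F fun k => boost j (-s) (x k)) x
        (Pi.single k (EuclideanSpace.single j.succ (1 : ℝ)))) = 𝒢 (s, x) := by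
    intro s x
    refine Finset.sum_congr rfl fun k _ => ?_
    congr 1
    exact fderiv_slice_apply (𝒢 := H) ((hH.differentiable (by simp)) _) _
  -- uniform bounds of the derivatives of `𝒢` on `[-s₀, s₀] × K`
  have hcpt : IsCompact (closedBall (0 : ℝ) s₀ ×ˢ (K : Set (Fin n → SpaceTime d))) :=
    (isCompact_closedBall _ _).prod (isCompact_closedBall _ _)
  have hMi : ∀ i : ℕ, ∃ Mi : ℝ, 0 ≤ Mi ∧ ∀ p ∈ closedBall (0 : ℝ) s₀ ×ˢ (K : Set (Fin n → SpaceTime d)),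
      ‖iteratedFDeriv ℝ i 𝒢 p‖ ≤ Mi := by
    intro i
    obtain ⟨Mi, hMi⟩ := hcpt.exists_bound_of_continuousOn
      ((h𝒢.continuous_iteratedFDeriv (by exact_mod_cast le_top)).continuousOn (s := _) : ContinuousOn (iteratedFDeriv ℝ i 𝒢) _)
    exact ⟨max Mi 0, le_max_right _ _, fun p hp => (hMi p hp).trans (le_max_left _ _)⟩
  choose Mi hMi0 hMi using hMi
  set Mtot : ℝ := ∑ i ∈ Finset.range (m + 1), Mi i with hMtot
  have hMtot0 : 0 ≤ Mtot := Finset.sum_nonneg fun i _ => hMi0 i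
  have hMi_le : ∀ i ∈ Finset.Iic m, Mi i ≤ Mtot := fun i hi =>
    Finset.single_le_sum (fun i _ => hMi0 i) (Finset.mem_range.2 (Nat.lt_succ_of_le (Finset.mem_Iic.1 hi)))
  refine ⟨C * Mtot, fun t ht s hs => ?_⟩
  -- the test function `𝒟(F ∘ B(−s))` as an element of `𝓓_K`
  have hDsmooth : ContDiff ℝ ∞ fun x : Fin n → SpaceTime d => 𝒢 (s, x) :=
    h𝒢.comp (contDiff_const.prodMk contDiff_id)
  have hDzero : EqOn (fun x : Fin n → SpaceTime d => 𝒢 (s, x)) 0 (K : Set (Fin n → SpaceTime d))ᶜ := by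
    intro x hx
    show 𝒢 (s, x) = 0
    rw [← h𝒢slice s x]
    simp only [hzero s hs x hx, zero_apply, mul_zero, Finset.sum_const_zero]
  let ψ : 𝓓_{K}((Fin n → SpaceTime d), ℂ) := ⟨fun x => 𝒢 (s, x), hDsmooth, hDzero⟩
  have hψ : ∀ x, ψ x = 𝒢 (s, x) := fun x => rfl
  -- its `C^m` norm
  have hsemi : ContDiffMapSupportedIn.supSeminorm ℝ (Fin n → SpaceTime d) ℂ ⊤ K m ψ ≤ Mtot := by
    refine Seminorm.finset_sup_apply_le hMtot0 fun i hi => ?_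
    refine (ContDiffMapSupportedIn.seminorm_top_le_iff ℝ hMtot0 i ψ).2 fun x hx => ?_
    calc ‖iteratedFDeriv ℝ i ψ x‖ = ‖iteratedFDeriv ℝ i (fun x => 𝒢 (s, x)) x‖ := rfl
      _ ≤ ‖iteratedFDeriv ℝ i 𝒢 (s, x)‖ := norm_iteratedFDeriv_slice_le h𝒢 s x i
      _ ≤ Mi i := hMi i (s, x) ⟨by simpa [Real.norm_eq_abs] using hs, hx⟩
      _ ≤ Mtot := hMi_le i hi
  calc ‖∫ x, 𝔚 (rayC x η ((t : ℂ) * I)) *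
        ∑ k, ((η k 0 : ℝ) : ℂ) * fderiv ℝ (fun x : Fin n → SpaceTime d => F fun k => boost j (-s) (x k)) x
          (Pi.single k (EuclideanSpace.single j.succ (1 : ℝ)))‖
      = ‖Λ t ψ‖ := by
        rw [hΛ ht.1 ψ]
        simp only [hψ, h𝒢slice]
    _ ≤ C * ContDiffMapSupportedIn.supSeminorm ℝ (Fin n → SpaceTime d) ℂ ⊤ K m ψ := hC t ht ψ
    _ ≤ C * Mtot := by gcongr

end Literature.MathematicalPhysics.QuantumFieldTheory
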